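import Mathlib
import Summits.Schanuel.Schanuel.Theses.RigidCore
import Summits.Schanuel.Schanuel.Theorems.MinimalCounterexampleInAcl.Negative.FirstFailureEcl
import Summits.Schanuel.Schanuel.Theorems.MinimalCounterexampleInAcl.Negative.TrdegLoadBearing
import Summits.Schanuel.Schanuel.Theorems.AclSubsetLogFreeCore.Negative.AclSubsetLogFreeCoreIffReal
import Summits.Schanuel.Schanuel.Theorems.AclSubsetLogFreeCore.Negative.LogFreeCoreCountable
import Summits.Schanuel.Schanuel.Theorems.AclSubsetLogFreeCore.Negative.BranchParity
import Literature.NumberTheory.Transcendental.LindemannWeierstrassProofs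
import Literature.NumberTheory.Transcendental.RankOneGridTrdeg

/-!
# Crux `MinimalCounterexampleInAcl` (stmt-Schanuel-0969) — load-bearing hypotheses

Negative knowledge for the crux (S*) `RigidCore.MinimalCounterexampleInAcl`
(`∀ n x, LinearIndependent ℚ x → trdeg ℚ(x, eˣ) < n → (∀ r < n, SchanuelRank r) → ∀ i, x i ∈ acl^{ℂ_exp}(∅)`),
landed by the crux disprover (`--supports`).  Which hypotheses can a proof NOT avoid?  All PROVED:

* `minimalCounterexampleInAcl_of_schanuel` — the crux is IMPLIED BY Schanuel (antecedent empty), and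
  `exists_firstFailure_of_not_schanuel` — its antecedent is satisfiable iff Schanuel FAILS: the crux is
  irrefutable short of an explicit Schanuel counterexample;
* `not_withoutTrdeg` — drop `trdeg < n`: FALSE by counting (`acl(∅)` is countable,
  `countable_expAcl`; rank 1, `x = (c)` generic);
* `not_schanuelRank_two_of_withoutLinIndep`, `not_schanuel_of_withoutLinIndep` — drop linear
  independence: the constant triple `(c,c,c)` has `trdeg ℚ(c, e^c) ≤ 2 < 3`, so the LI-free version
  would put EVERY `c ∈ ℂ` into the countable `acl(∅)` as soon as `SchanuelRank 2` holds: it REFUTES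
  Schanuel, while the crux is implied by it;
* `withLe_mem_of_exp_algebraic`, `withLe_log_two_branch_mem` — `≤` for `<`: every logarithm of every
  non-zero algebraic number (all branches `log 2 + 2πik`, …) would be in `acl(∅)`; not refutable (no
  complex number is provably outside `acl(∅)`) but it decides Mycielski-type questions the crux avoids;
* `withoutFirstFailure_defectLeOne` — drop `∀ r < n, SchanuelRank r`: the statement then proves the
  OPEN transcendence theorem "defect ≤ 1 at every rank" (`trdeg ℚ(x, eˣ) ≥ n − 1` for all LI `x`), by
  PADDING a putative defect-2 tuple with a generic coordinate `c ∉ acl(∅) ∪ ⟨x⟩_ℚ`.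

## References

* [KirbyMacintyreOnshuus2012] J. Kirby, A. Macintyre, A. Onshuus, *The algebraic numbers definable
  in various exponential fields*, J. Inst. Math. Jussieu 11 (2012), arXiv:1101.4224 (`acl`, `dcl` of
  `ℂ_exp`; countability).
* J. Kirby, *Exponential algebraicity in exponential fields*, Bull. LMS 42 (2010), arXiv:0810.4285, §1.
-/

noncomputable section

set_option linter.dupNamespace false

open Complex Set
open FirstOrder FirstOrder.Language
open Literature.NumberTheory.Transcendental
open Literature.ModelTheory.ExponentialFields
open Summit.Schanuel.Schanuel.Theorems.AclSubsetLogFreeCore.Negative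

namespace Summit.Schanuel.Schanuel.Theorems.MinimalCounterexampleInAcl.Negative

/-! ### The crux versus Schanuel -/

/-- The crux is IMPLIED BY Schanuel's conjecture (its antecedent is then empty). [folklore] -/
theorem minimalCounterexampleInAcl_of_schanuel (h : _root_.Schanuel) :
    Summit.Schanuel.Schanuel.Theses.RigidCore.MinimalCounterexampleInAcl :=
  fun n x hli htr _ _ => ((not_le.2 htr) (h n x hli)).elim

/-- Conversely a failure of Schanuel produces a FIRST failure (least failing rank), i.e. the crux's
antecedent is satisfiable iff Schanuel fails. [folklore] -/
theorem exists_firstFailure_of_not_schanuel (h : ¬ _root_.Schanuel) :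
    ∃ (n : ℕ) (x : Fin n → ℂ), LinearIndependent ℚ x ∧
      Algebra.trdeg ℚ ↥(IntermediateField.adjoin ℚ (range x ∪ range (cexp ∘ x))) < (n : Cardinal) ∧
      ∀ r < n, SchanuelRank r := by
  classical
  have h' : ∃ n, ¬ SchanuelRank n := by
    by_contra hall
    push Not at hall
    exact h hall
  let n := Nat.find h'
  have hn : ¬ SchanuelRank n := Nat.find_spec h'
  have hmin : ∀ r < n, SchanuelRank r := fun r hr => by
    by_contra hr'
    exact Nat.find_min h' hr hr'
  simp only [SchanuelRank, not_forall, not_le] at hn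
  obtain ⟨x, hli, hlt⟩ := hn
  exact ⟨n, x, hli, hlt, hmin⟩

/-! ### Tools -/

/-- Any countable set of complex numbers misses some complex number. [folklore] -/
theorem exists_not_mem_of_countable {s : Set ℂ} (hs : s.Countable) : ∃ c : ℂ, c ∉ s := by
  by_contra h
  push Not at h
  exact not_countable_univ_complex (hs.mono fun c _ => h c)

/-- `trdeg ℚ(c, e^c) ≤ 2`. [folklore] -/
theorem trdeg_pair_le_two (c : ℂ) :
    Algebra.trdeg ℚ ↥(IntermediateField.adjoin ℚ ({c} ∪ {cexp c} : Set ℂ)) ≤ (2 : Cardinal) := by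
  refine (trdeg_adjoin_le_mk _).trans ?_
  refine (Cardinal.mk_union_le _ _).trans ?_
  simp only [Cardinal.mk_fintype, Fintype.card_unique, Nat.cast_one]
  norm_num

/-- `trdeg ℚ(c, e^c) ≤ 1` when `e^c` is algebraic. [folklore] -/
theorem trdeg_pair_le_one_of_exp_algebraic {c : ℂ} (hc : IsAlgebraic ℚ (cexp c)) :
    Algebra.trdeg ℚ ↥(IntermediateField.adjoin ℚ ({c} ∪ {cexp c} : Set ℂ)) ≤ (1 : Cardinal) := by
  refine (trdeg_adjoin_union_le (K := ℚ) ({c} : Set ℂ) {cexp c}).trans ?_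
  have h1 : Algebra.trdeg ℚ ↥(IntermediateField.adjoin ℚ ({c} : Set ℂ)) ≤ 1 := by
    have h := trdeg_adjoin_le_mk (F := ℚ) ({c} : Set ℂ)
    rwa [Cardinal.mk_singleton] at h
  have h0 : Algebra.trdeg ℚ ↥(IntermediateField.adjoin ℚ ({cexp c} : Set ℂ)) = 0 := by
    haveI : Algebra.IsAlgebraic ℚ ↥(IntermediateField.adjoin ℚ ({cexp c} : Set ℂ)) :=
      IntermediateField.isAlgebraic_adjoin_simple hc.isIntegral
    exact trdeg_eq_zero
  calc Algebra.trdeg ℚ ↥(IntermediateField.adjoin ℚ ({c} : Set ℂ)) +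
        Algebra.trdeg ℚ ↥(IntermediateField.adjoin ℚ ({cexp c} : Set ℂ))
        = Algebra.trdeg ℚ ↥(IntermediateField.adjoin ℚ ({c} : Set ℂ)) + 0 := by rw [h0]
    _ ≤ 1 := by rw [add_zero]; exact h1

/-- The range data of a constant tuple. [folklore] -/
theorem range_const_union {n : ℕ} [NeZero n] (c : ℂ) :
    range (fun _ : Fin n => c) ∪ range (cexp ∘ fun _ : Fin n => c) = ({c} ∪ {cexp c} : Set ℂ) := by
  ext a
  simp only [mem_union, mem_range, Function.comp_apply, exists_const, mem_singleton_iff]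
  constructor
  · rintro (rfl | rfl) <;> simp
  · rintro (rfl | rfl) <;> simp

/-! ### `trdeg < n` is load-bearing -/

/-- **Without `trdeg < n` the statement is FALSE** (counting: rank 1, `x = (c)` with
`c ∉ acl(∅) ∪ {0}`; `acl(∅)` is countable, `ℂ` is not; `SchanuelRank 0` is trivial). [folklore] -/
theorem not_withoutTrdeg :
    ¬ ∀ (n : ℕ) (x : Fin n → ℂ), LinearIndependent ℚ x → (∀ r < n, SchanuelRank r) →
        ∀ i, ∃ s : Set ℂ, s.Finite ∧ Set.Definable₁ (∅ : Set ℂ) Language.expRing s ∧ x i ∈ s := by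
  intro h
  obtain ⟨c, hc⟩ := exists_not_mem_of_countable (countable_expAcl.insert 0)
  simp only [mem_insert_iff, not_or] at hc
  exact hc.2 (h 1 (fun _ => c) (linearIndependent_const_fin_one hc.1) schanuelRank_of_lt_one 0)

/-! ### Linear independence is load-bearing -/

/-- **Without linear independence, the statement contradicts `SchanuelRank 2`**: the constant triple
`(c, c, c)` has `trdeg ℚ(c, e^c) ≤ 2 < 3`, so EVERY `c ∈ ℂ` would lie in the countable `acl(∅)`. [folklore] -/
theorem not_schanuelRank_two_of_withoutLinIndep
    (h : ∀ (n : ℕ) (x : Fin n → ℂ),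
      Algebra.trdeg ℚ ↥(IntermediateField.adjoin ℚ (range x ∪ range (cexp ∘ x))) < (n : Cardinal) →
      (∀ r < n, SchanuelRank r) →
      ∀ i, ∃ s : Set ℂ, s.Finite ∧ Set.Definable₁ (∅ : Set ℂ) Language.expRing s ∧ x i ∈ s) :
    ¬ SchanuelRank 2 := by
  intro h2
  obtain ⟨c, hc⟩ := exists_not_mem_of_countable countable_expAcl
  have hrank : ∀ r < 3, SchanuelRank r := fun r hr => by
    interval_cases r
    · exact schanuelRank_zero
    · exact schanuelRank_one'
    · exact h2
  have htr : Algebra.trdeg ℚ ↥(IntermediateField.adjoin ℚ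
      (range (fun _ : Fin 3 => c) ∪ range (cexp ∘ fun _ : Fin 3 => c))) < (3 : Cardinal) := by
    rw [range_const_union]
    exact (trdeg_pair_le_two c).trans_lt (by norm_num)
  exact hc (h 3 (fun _ => c) (by exact_mod_cast htr) hrank 0)

/-- **Unconditional form**: the LI-free version REFUTES Schanuel's conjecture — whereas the crux
itself is implied by it (`minimalCounterexampleInAcl_of_schanuel`). [folklore] -/
theorem not_schanuel_of_withoutLinIndep
    (h : ∀ (n : ℕ) (x : Fin n → ℂ),
      Algebra.trdeg ℚ ↥(IntermediateField.adjoin ℚ (range x ∪ range (cexp ∘ x))) < (n : Cardinal) →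
      (∀ r < n, SchanuelRank r) →
      ∀ i, ∃ s : Set ℂ, s.Finite ∧ Set.Definable₁ (∅ : Set ℂ) Language.expRing s ∧ x i ∈ s) :
    ¬ _root_.Schanuel :=
  fun hS => not_schanuelRank_two_of_withoutLinIndep h (hS 2)

/-! ### `<` versus `≤` -/

/-- **With `≤` in place of `<`**, EVERY logarithm of EVERY nonzero algebraic number — all branches —
would lie in `acl^{ℂ_exp}(∅)` (rank 1: `x = (c)`, `e^c ∈ ℚ̄`, `trdeg ℚ(c, e^c) ≤ 1`). Not refutable, but
it decides Mycielski-type questions the crux deliberately avoids; the strict `<` keeps defect-zero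
tuples out. [folklore] -/
theorem withLe_mem_of_exp_algebraic
    (h : ∀ (n : ℕ) (x : Fin n → ℂ), LinearIndependent ℚ x →
      Algebra.trdeg ℚ ↥(IntermediateField.adjoin ℚ (range x ∪ range (cexp ∘ x))) ≤ (n : Cardinal) →
      (∀ r < n, SchanuelRank r) →
      ∀ i, ∃ s : Set ℂ, s.Finite ∧ Set.Definable₁ (∅ : Set ℂ) Language.expRing s ∧ x i ∈ s)
    {c : ℂ} (hc0 : c ≠ 0) (hc : IsAlgebraic ℚ (cexp c)) : c ∈ expAcl := by
  haveI : NeZero (1 : ℕ) := ⟨one_ne_zero⟩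
  have htr : Algebra.trdeg ℚ ↥(IntermediateField.adjoin ℚ
      (range (fun _ : Fin 1 => c) ∪ range (cexp ∘ fun _ : Fin 1 => c))) ≤ (1 : Cardinal) := by
    rw [range_const_union]
    exact trdeg_pair_le_one_of_exp_algebraic hc
  exact h 1 (fun _ => c) (linearIndependent_const_fin_one hc0) (by exact_mod_cast htr) schanuelRank_of_lt_one 0

/-- In particular the `≤`-version puts every branch `log 2 + 2πik` of `log 2` into `acl(∅)`. [folklore] -/
theorem withLe_log_two_branch_mem
    (h : ∀ (n : ℕ) (x : Fin n → ℂ), LinearIndependent ℚ x →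
      Algebra.trdeg ℚ ↥(IntermediateField.adjoin ℚ (range x ∪ range (cexp ∘ x))) ≤ (n : Cardinal) →
      (∀ r < n, SchanuelRank r) →
      ∀ i, ∃ s : Set ℂ, s.Finite ∧ Set.Definable₁ (∅ : Set ℂ) Language.expRing s ∧ x i ∈ s)
    (k : ℤ) : (Real.log 2 : ℂ) + 2 * Real.pi * I * k ∈ expAcl := by
  have h1 : cexp (2 * ↑Real.pi * I * ↑k) = 1 := by
    rw [show (2 * ↑Real.pi * I * ↑k : ℂ) = k * (2 * Real.pi * I) by ring]
    exact Complex.exp_int_mul_two_pi_mul_I k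
  have hexp : cexp ((Real.log 2 : ℂ) + 2 * Real.pi * I * k) = 2 := by
    rw [Complex.exp_add, exp_log_two, h1, mul_one]
  refine withLe_mem_of_exp_algebraic h ?_ ?_
  · intro h0
    rw [h0, Complex.exp_zero] at hexp
    norm_num at hexp
  · rw [hexp]
    exact_mod_cast isAlgebraic_nat (R := ℚ) (A := ℂ) 2

/-! ### The first-failure hypothesis is load-bearing: dropping it proves "defect ≤ 1" -/

/-- The ℚ-span of finitely many complex numbers is countable. [folklore] -/
theorem countable_span_range {n : ℕ} (x : Fin n → ℂ) :
    ((Submodule.span ℚ (range x) : Submodule ℚ ℂ) : Set ℂ).Countable := by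
  have hsub : ((Submodule.span ℚ (range x) : Submodule ℚ ℂ) : Set ℂ) ⊆
      Set.range (fun q : Fin n → ℚ => ∑ i, q i • x i) := by
    intro a ha
    obtain ⟨q, rfl⟩ := (Submodule.mem_span_range_iff_exists_fun ℚ).1 ha
    exact ⟨q, rfl⟩
  exact (Set.countable_range _).mono hsub

/-- Range bookkeeping for a padded tuple `(c, x)`. [folklore] -/
theorem range_cons_union {n : ℕ} (c : ℂ) (x : Fin n → ℂ) :
    range (Fin.cons c x : Fin (n + 1) → ℂ) ∪ range (cexp ∘ (Fin.cons c x : Fin (n + 1) → ℂ)) =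
      ({c} ∪ {cexp c}) ∪ (range x ∪ range (cexp ∘ x)) := by
  have h2 : (cexp ∘ (Fin.cons c x : Fin (n + 1) → ℂ)) = Fin.cons (cexp c) (cexp ∘ x) := by
    funext i
    refine Fin.cases ?_ (fun j => ?_) i <;> simp
  rw [h2, Fin.range_cons, Fin.range_cons]
  ext a
  simp only [mem_union, mem_insert_iff, mem_singleton_iff]
  tauto

/-- **Dropping the first-failure hypothesis `∀ r < n, SchanuelRank r` costs an open transcendence
theorem**: the statement "every Schanuel counterexample has all coordinates in `acl(∅)`" implies
"defect ≤ 1 at every rank" (`trdeg ℚ(x, eˣ) ≥ n − 1` for every LI `x ∈ ℂⁿ`; open, Schanuel-strength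
minus one), by PADDING: a defect-`≥ 2` tuple `x` extended by `c ∉ acl(∅) ∪ ⟨x⟩_ℚ` is an LI
counterexample at rank `n + 1` with the coordinate `c` outside `acl(∅)`. [folklore] -/
theorem withoutFirstFailure_defectLeOne
    (h : ∀ (n : ℕ) (x : Fin n → ℂ), LinearIndependent ℚ x →
      Algebra.trdeg ℚ ↥(IntermediateField.adjoin ℚ (range x ∪ range (cexp ∘ x))) < (n : Cardinal) →
      ∀ i, ∃ s : Set ℂ, s.Finite ∧ Set.Definable₁ (∅ : Set ℂ) Language.expRing s ∧ x i ∈ s)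
    (n : ℕ) (x : Fin n → ℂ) (hli : LinearIndependent ℚ x) :
    ((n - 1 : ℕ) : Cardinal) ≤ Algebra.trdeg ℚ ↥(IntermediateField.adjoin ℚ (range x ∪ range (cexp ∘ x))) := by
  by_contra hlt
  rw [not_le] at hlt
  obtain ⟨k, hk⟩ := Cardinal.lt_aleph0.1 (hlt.trans Cardinal.natCast_lt_aleph0)
  have hkn : k < n - 1 := by rw [hk] at hlt; exact_mod_cast hlt
  obtain ⟨c, hc⟩ := exists_not_mem_of_countable (countable_expAcl.union (countable_span_range x))
  simp only [mem_union, not_or, SetLike.mem_coe] at hc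
  have hli' : LinearIndependent ℚ (Fin.cons c x : Fin (n + 1) → ℂ) :=
    LinearIndependent.finCons hli hc.2
  have htr : Algebra.trdeg ℚ ↥(IntermediateField.adjoin ℚ
      (range (Fin.cons c x : Fin (n + 1) → ℂ) ∪ range (cexp ∘ (Fin.cons c x : Fin (n + 1) → ℂ)))) <
        ((n + 1 : ℕ) : Cardinal) := by
    rw [range_cons_union]
    calc Algebra.trdeg ℚ ↥(IntermediateField.adjoin ℚ (({c} ∪ {cexp c}) ∪ (range x ∪ range (cexp ∘ x))))
          ≤ Algebra.trdeg ℚ ↥(IntermediateField.adjoin ℚ ({c} ∪ {cexp c} : Set ℂ)) +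
            Algebra.trdeg ℚ ↥(IntermediateField.adjoin ℚ (range x ∪ range (cexp ∘ x))) :=
            trdeg_adjoin_union_le _ _
      _ ≤ (2 : Cardinal) + (k : Cardinal) := add_le_add (trdeg_pair_le_two c) hk.le
      _ < ((n + 1 : ℕ) : Cardinal) := by norm_cast; omega
  have hmem := h (n + 1) (Fin.cons c x) hli' htr 0
  simp only [Fin.cons_zero] at hmem
  exact hc.1 hmem

end Summit.Schanuel.Schanuel.Theorems.MinimalCounterexampleInAcl.Negative

end
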